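import Mathlib.Analysis.SpecialFunctions.ImproperIntegrals
import Mathlib.Analysis.SpecialFunctions.Integrals.Basic
import Mathlib.Analysis.SpecialFunctions.Pow.Real
import HarnessLib

/-!
# Logarithmically damped power weights: slow variation and two radial integrals

Analysis/FluidPDE support file (theorems only, no definitions, no named facts) on the discharge
path of the named fact `Literature.Analysis.FluidPDE.wangYang2026_liouville_vorticity_log`
(`SteadyNSLiouville.lean`; W. Wang, G. Yang, arXiv:2608.06040, Theorem 1.6). The decay profiles
of that paper are `Φ_{β,γ}(s) = s^{-β} L(s)^{-γ}` with `L(s) = log(e + s)` ((1.13)–(1.14),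
(4.13) and Lemma A.2, p. 24), and the proofs of Lemma A.1/A.2 (pp. 22–24) use, without comment,
the elementary calculus of the weight `L` collected here:

* `one_le_log_exp_one_add`, `log_exp_one_add_mono`, `log_exp_one_add_le_two_mul_half` —
  `L ≥ 1`, `L` is increasing, and the doubling bound `L(s) ≤ 2 L(s/2)`;
* `log_exp_one_add_rpow_le_mul` — **slow variation**: for `0 < s ≤ t` and `ε, γ > 0`,
  `L(t)^γ ≤ (1 + γ/ε)^γ (t/s)^ε L(s)^γ` (from `L(t) ≤ L(s) + log(t/s)` and
  `log v ≤ v^δ/δ`); in particular `L(t)^γ ≤ C t^ε` for `t ≥ 1` (`log_exp_one_add_rpow_le`);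
* `lintegral_Ioc_rpow_div_log_le` — `∫₁ʳ s^{1-β} L(s)^{-γ} ds ≤ K r^{2-β} L(r)^{-γ}` for
  `1 < β < 2` (the integral over `D₁` in the proof of Lemma A.1/A.2:
  "`≤ C r^{-1} ∫₀^{r/2} (1+ρ)^{-a} [log(e+ρ)]^β ρ dρ ≤ C r^{1-a} [log(e+r)]^β`", p. 22, here with
  the decaying logarithm of Lemma A.2);
* `lintegral_Ioi_rpow_log_le` — `∫ᵣ^∞ s^{-β} L(s)^{-γ} ds ≤ r^{1-β} L(r)^{-γ}/(β-1)` for `β > 1`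
  (the integral over `D₃`, p. 23).

All integrals are stated as lower Lebesgue integrals of `ENNReal.ofReal` of the (nonnegative)
integrands, the form consumed by the planar potential estimate.

## References

* W. Wang, G. Yang, *New decay estimates and Liouville type theorems for the 3D axisymmetric
  stationary Navier–Stokes equations*, arXiv:2608.06040 (2026), Appendix A, Lemmas A.1–A.2.
  [WangYang2026]
-/

noncomputable section

open Real Set MeasureTheory

namespace Literature.Analysis.FluidPDE

/-! ### The weight `L(s) = log(e + s)` -/

/-- `L(s) = log(e + s) ≥ 1` for `s ≥ 0`. [folklore] -/
theorem one_le_log_exp_one_add {s : ℝ} (hs : 0 ≤ s) : 1 ≤ log (exp 1 + s) := by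
  rw [le_log_iff_exp_le (by positivity)]
  linarith

/-- `L(s) = log(e + s) > 0` for `s ≥ 0`. [folklore] -/
theorem log_exp_one_add_pos {s : ℝ} (hs : 0 ≤ s) : 0 < log (exp 1 + s) :=
  one_pos.trans_le (one_le_log_exp_one_add hs)

/-- `L` is increasing on `[0, ∞)`. [folklore] -/
theorem log_exp_one_add_mono {s t : ℝ} (hs : 0 ≤ s) (hst : s ≤ t) :
    log (exp 1 + s) ≤ log (exp 1 + t) :=
  log_le_log (by positivity) (by linarith)

/-- **Doubling**: `L(s) ≤ 2 L(s/2)` for `s ≥ 0` (`e + s ≤ (e + s/2)²` as `e ≥ 1`). [folklore] -/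
theorem log_exp_one_add_le_two_mul_half {s : ℝ} (hs : 0 ≤ s) :
    log (exp 1 + s) ≤ 2 * log (exp 1 + s / 2) := by
  have he : 1 ≤ exp 1 := by
    have := add_one_le_exp (1 : ℝ)
    linarith
  have hpos : 0 < exp 1 + s / 2 := by positivity
  rw [← log_rpow hpos 2]
  refine log_le_log (by positivity) ?_
  rw [rpow_two]
  nlinarith [mul_nonneg (sub_nonneg.2 he) hs, sq_nonneg s]

/-- **Ratio bound**: `L(t) ≤ L(s) + log(t/s)` for `0 < s ≤ t` (`(e + t)/(e + s) ≤ t/s`).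
[folklore] -/
theorem log_exp_one_add_le_add_log_div {s t : ℝ} (hs : 0 < s) (hst : s ≤ t) :
    log (exp 1 + t) ≤ log (exp 1 + s) + log (t / s) := by
  have ht : 0 < t := hs.trans_le hst
  rw [← log_mul (by positivity) (by positivity)]
  refine log_le_log (by positivity) ?_
  rw [mul_div_assoc', le_div_iff₀ hs]
  nlinarith [exp_pos 1]

/-- **Slow variation of the logarithmic weight**: for `0 < s ≤ t` and `ε, γ > 0`,
`L(t)^γ ≤ (1 + γ/ε)^γ (t/s)^ε L(s)^γ`. Proof: `L(t) ≤ L(s)(1 + log(t/s))` (ratio bound and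
`L(s) ≥ 1`) and `1 + log v ≤ (1 + 1/δ) v^δ` with `δ = ε/γ` (`log v ≤ v^δ/δ`). This is the
elementary fact behind the preservation of the logarithmic factor in Wang–Yang's Lemma A.1/A.2.
[cite: WangYang2026, Lemma A.1 (proof), p. 22] -/
theorem log_exp_one_add_rpow_le_mul {ε γ s t : ℝ} (hε : 0 < ε) (hγ : 0 < γ) (hs : 0 < s)
    (hst : s ≤ t) :
    log (exp 1 + t) ^ γ ≤ (1 + γ / ε) ^ γ * (t / s) ^ ε * log (exp 1 + s) ^ γ := by
  set Ls := log (exp 1 + s) with hLs_def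
  set Lt := log (exp 1 + t) with hLt_def
  have ht : 0 < t := hs.trans_le hst
  have hLs : 1 ≤ Ls := one_le_log_exp_one_add hs.le
  have hLt : 0 < Lt := log_exp_one_add_pos ht.le
  set v := t / s with hv
  have hv1 : 1 ≤ v := (one_le_div hs).2 hst
  have hv0 : 0 ≤ v := zero_le_one.trans hv1
  -- `L t ≤ L s (1 + log v)`
  have h1 : Lt ≤ Ls * (1 + log v) := by
    have h := log_exp_one_add_le_add_log_div hs hst
    have hlogv : 0 ≤ log v := log_nonneg hv1
    calc Lt ≤ Ls + log v := h
      _ ≤ Ls + Ls * log v := by nlinarith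
      _ = Ls * (1 + log v) := by ring
  -- `1 + log v ≤ (1 + γ/ε) v^{ε/γ}`
  have hδ : 0 < ε / γ := div_pos hε hγ
  have h2 : 1 + log v ≤ (1 + γ / ε) * v ^ (ε / γ) := by
    have hl : log v ≤ v ^ (ε / γ) / (ε / γ) := log_le_rpow_div hv0 hδ
    have h1v : 1 ≤ v ^ (ε / γ) := one_le_rpow hv1 hδ.le
    calc 1 + log v ≤ v ^ (ε / γ) + v ^ (ε / γ) / (ε / γ) := add_le_add h1v hl
      _ = (1 + γ / ε) * v ^ (ε / γ) := by
          have hε0 : ε ≠ 0 := hε.ne'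
          have hγ0 : γ ≠ 0 := hγ.ne'
          field_simp
  have h12 : Lt ≤ Ls * ((1 + γ / ε) * v ^ (ε / γ)) :=
    h1.trans (mul_le_mul_of_nonneg_left h2 (by linarith))
  have h3 : Lt ^ γ ≤ (Ls * ((1 + γ / ε) * v ^ (ε / γ))) ^ γ := rpow_le_rpow hLt.le h12 hγ.le
  have h4 : (Ls * ((1 + γ / ε) * v ^ (ε / γ))) ^ γ = (1 + γ / ε) ^ γ * v ^ ε * Ls ^ γ := by
    rw [mul_rpow (by linarith) (by positivity), mul_rpow (by positivity) (by positivity),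
      ← rpow_mul hv0, div_mul_cancel₀ ε hγ.ne']
    ring
  exact h3.trans_eq h4

/-- **`log ≤ power`**: for `ε, γ > 0` and `t ≥ 1`, `L(t)^γ ≤ (1 + γ/ε)^γ L(1)^γ t^ε`. [folklore] -/
theorem log_exp_one_add_rpow_le {ε γ t : ℝ} (hε : 0 < ε) (hγ : 0 < γ) (ht : 1 ≤ t) :
    log (exp 1 + t) ^ γ ≤ (1 + γ / ε) ^ γ * log (exp 1 + 1) ^ γ * t ^ ε := by
  have h := log_exp_one_add_rpow_le_mul hε hγ one_pos ht
  rw [div_one] at h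
  exact h.trans_eq (by ring)

/-! ### Two radial integrals -/

/-- The profile of the inner region: for `1 ≤ s ≤ r`,
`s / (s^β L(s)^γ) ≤ (1 + 2γ/(2-β))^γ r^{(2-β)/2} L(r)^{-γ} s^{1-β-(2-β)/2}` (slow variation
with `ε = (2 - β)/2`). [folklore] -/
theorem div_rpow_mul_log_rpow_le {β γ s r : ℝ} (hβ2 : β < 2) (hγ : 0 < γ) (hs1 : 1 ≤ s)
    (hsr : s ≤ r) :
    s / (s ^ β * log (exp 1 + s) ^ γ) ≤
      (1 + γ / ((2 - β) / 2)) ^ γ * r ^ ((2 - β) / 2) / log (exp 1 + r) ^ γ *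
        s ^ (1 - β - (2 - β) / 2) := by
  set ε := (2 - β) / 2 with hε_def
  have hε : 0 < ε := by rw [hε_def]; linarith
  have hs : 0 < s := one_pos.trans_le hs1
  have hr : 0 < r := hs.trans_le hsr
  set M := (1 + γ / ε) ^ γ with hM
  have hLs : 0 < log (exp 1 + s) := log_exp_one_add_pos hs.le
  have hLr : 0 < log (exp 1 + r) := log_exp_one_add_pos hr.le
  have hLsγ : 0 < log (exp 1 + s) ^ γ := rpow_pos_of_pos hLs γ
  have hLrγ : 0 < log (exp 1 + r) ^ γ := rpow_pos_of_pos hLr γ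
  have hsβ : 0 < s ^ β := rpow_pos_of_pos hs β
  -- slow variation: `L(r)^γ ≤ M (r/s)^ε L(s)^γ`
  have hslow := log_exp_one_add_rpow_le_mul hε hγ hs hsr
  -- rewrite the powers of `s`
  have hpow : s / s ^ β = s ^ (1 - β) := by
    rw [rpow_sub hs, rpow_one]
  have hsplit : s ^ (1 - β) = s ^ ε * s ^ (1 - β - ε) := by
    rw [← rpow_add hs]; ring_nf
  have hrs : (r / s) ^ ε * s ^ ε = r ^ ε := by
    rw [div_rpow hr.le hs.le, div_mul_cancel₀ _ (rpow_pos_of_pos hs ε).ne']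
  calc s / (s ^ β * log (exp 1 + s) ^ γ)
      = s ^ (1 - β) / log (exp 1 + s) ^ γ := by rw [← div_div, hpow]
    _ = s ^ ε * s ^ (1 - β - ε) / log (exp 1 + s) ^ γ := by rw [hsplit]
    _ ≤ s ^ ε * s ^ (1 - β - ε) * (M * (r / s) ^ ε / log (exp 1 + r) ^ γ) := by
        -- `1/L(s)^γ ≤ M (r/s)^ε / L(r)^γ`
        have hkey : (log (exp 1 + s) ^ γ)⁻¹ ≤ M * (r / s) ^ ε / log (exp 1 + r) ^ γ := by
          rw [inv_le_iff_one_le_mul₀' hLsγ, ← mul_div_assoc, one_le_div hLrγ]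
          calc log (exp 1 + r) ^ γ ≤ M * (r / s) ^ ε * log (exp 1 + s) ^ γ := hslow
            _ = log (exp 1 + s) ^ γ * (M * (r / s) ^ ε) := by ring
        calc s ^ ε * s ^ (1 - β - ε) / log (exp 1 + s) ^ γ
            = s ^ ε * s ^ (1 - β - ε) * (log (exp 1 + s) ^ γ)⁻¹ := div_eq_mul_inv _ _
          _ ≤ _ := mul_le_mul_of_nonneg_left hkey (by positivity)
    _ = M * r ^ ε / log (exp 1 + r) ^ γ * s ^ (1 - β - ε) := by
        rw [← hrs]; ring

/-- **The inner radial integral** (region `D₁` of Wang–Yang's Lemma A.2): for `1 < β < 2`,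
`γ > 0` and `r ≥ 1`,
`∫_{(1,r]} s/(s^β L(s)^γ) ds ≤ K r^{2-β} L(r)^{-γ}` with
`K = (1 + 2γ/(2-β))^γ · 2/(2-β)` (pointwise slow-variation bound and `∫₁ʳ s^p = (r^{p+1}-1)/(p+1)`).
[cite: WangYang2026, Lemma A.2 (A.2), p. 24] -/
theorem lintegral_Ioc_rpow_div_log_le {β γ r : ℝ} (hβ2 : β < 2) (hγ : 0 < γ) (hr : 1 ≤ r) :
    ∫⁻ s in Ioc 1 r, ENNReal.ofReal (s / (s ^ β * log (exp 1 + s) ^ γ)) ≤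
      ENNReal.ofReal ((1 + γ / ((2 - β) / 2)) ^ γ * (2 / (2 - β)) *
        (r ^ (2 - β) / log (exp 1 + r) ^ γ)) := by
  set ε := (2 - β) / 2 with hε_def
  have hε : 0 < ε := by rw [hε_def]; linarith
  have hr0 : 0 < r := one_pos.trans_le hr
  set M := (1 + γ / ε) ^ γ with hM
  set p := 1 - β - ε with hp
  have hp1 : -1 < p := by rw [hp, hε_def]; linarith
  have hp0 : 0 < p + 1 := by linarith
  have hLr : 0 < log (exp 1 + r) := log_exp_one_add_pos hr0.le
  have hLrγ : 0 < log (exp 1 + r) ^ γ := rpow_pos_of_pos hLr γ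
  set c := M * r ^ ε / log (exp 1 + r) ^ γ with hc
  have hc0 : 0 ≤ c := by positivity
  -- pointwise bound on `(1, r]`
  have hpt : ∀ s ∈ Ioc 1 r, ENNReal.ofReal (s / (s ^ β * log (exp 1 + s) ^ γ)) ≤
      ENNReal.ofReal c * ENNReal.ofReal (s ^ p) := by
    intro s hs
    rw [← ENNReal.ofReal_mul hc0]
    exact ENNReal.ofReal_le_ofReal (div_rpow_mul_log_rpow_le hβ2 hγ hs.1.le hs.2)
  -- the power integral
  have hint : ∫⁻ s in Ioc 1 r, ENNReal.ofReal (s ^ p) = ENNReal.ofReal ((r ^ (p + 1) - 1) / (p + 1)) := by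
    have hii : IntervalIntegrable (fun s : ℝ => s ^ p) volume 1 r :=
      intervalIntegral.intervalIntegrable_rpow' hp1
    rw [← ofReal_integral_eq_lintegral_ofReal ((intervalIntegrable_iff_integrableOn_Ioc_of_le hr).1 hii)
      (ae_restrict_of_forall_mem measurableSet_Ioc fun s hs => rpow_nonneg (zero_le_one.trans hs.1.le) _),
      ← intervalIntegral.integral_of_le hr, integral_rpow (Or.inl hp1), one_rpow]
  calc ∫⁻ s in Ioc 1 r, ENNReal.ofReal (s / (s ^ β * log (exp 1 + s) ^ γ))
      ≤ ∫⁻ s in Ioc 1 r, ENNReal.ofReal c * ENNReal.ofReal (s ^ p) :=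
        setLIntegral_mono' measurableSet_Ioc hpt
    _ = ENNReal.ofReal c * ENNReal.ofReal ((r ^ (p + 1) - 1) / (p + 1)) := by
        rw [lintegral_const_mul' _ _ ENNReal.ofReal_ne_top, hint]
    _ ≤ ENNReal.ofReal c * ENNReal.ofReal (r ^ (p + 1) / (p + 1)) := by
        gcongr
        linarith
    _ = ENNReal.ofReal (M * (2 / (2 - β)) * (r ^ (2 - β) / log (exp 1 + r) ^ γ)) := by
        rw [← ENNReal.ofReal_mul hc0, hc]
        congr 1
        have hp1' : p + 1 = 2 - β - ε := by rw [hp]; ring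
        have hsum : r ^ ε * r ^ (p + 1) = r ^ (2 - β) := by
          rw [← rpow_add hr0, hp1']; ring_nf
        have h2 : p + 1 = (2 - β) / 2 := by rw [hp1', hε_def]; ring
        rw [h2] at hsum ⊢
        field_simp
        rw [← hsum]
        ring

/-- **The outer radial integral** (region `D₃` of Wang–Yang's Lemma A.2): for `β > 1`,
`γ ≥ 0` and `r > 0`, `∫_{(r,∞)} (s^β L(s)^γ)⁻¹ ds ≤ r^{1-β}/((β-1) L(r)^γ)` (`L` is increasing
and `∫ᵣ^∞ s^{-β} = r^{1-β}/(β-1)`). [cite: WangYang2026, Lemma A.2 (A.2), p. 24] -/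
theorem lintegral_Ioi_rpow_log_le {β γ r : ℝ} (hβ : 1 < β) (hγ : 0 ≤ γ) (hr : 0 < r) :
    ∫⁻ s in Ioi r, ENNReal.ofReal ((s ^ β * log (exp 1 + s) ^ γ)⁻¹) ≤
      ENNReal.ofReal (r ^ (1 - β) / ((β - 1) * log (exp 1 + r) ^ γ)) := by
  have hLr : 0 < log (exp 1 + r) := log_exp_one_add_pos hr.le
  have hLrγ : 0 < log (exp 1 + r) ^ γ := rpow_pos_of_pos hLr γ
  set c := (log (exp 1 + r) ^ γ)⁻¹ with hc
  have hc0 : 0 ≤ c := by positivity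
  have hpt : ∀ s ∈ Ioi r, ENNReal.ofReal ((s ^ β * log (exp 1 + s) ^ γ)⁻¹) ≤
      ENNReal.ofReal c * ENNReal.ofReal (s ^ (-β)) := by
    intro s hs
    have hs0 : 0 < s := hr.trans hs
    rw [← ENNReal.ofReal_mul hc0]
    refine ENNReal.ofReal_le_ofReal ?_
    have hmono : log (exp 1 + r) ^ γ ≤ log (exp 1 + s) ^ γ :=
      rpow_le_rpow hLr.le (log_exp_one_add_mono hr.le hs.le) hγ
    calc (s ^ β * log (exp 1 + s) ^ γ)⁻¹ = (s ^ β)⁻¹ * (log (exp 1 + s) ^ γ)⁻¹ := mul_inv _ _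
      _ ≤ (s ^ β)⁻¹ * (log (exp 1 + r) ^ γ)⁻¹ :=
          mul_le_mul_of_nonneg_left (inv_anti₀ hLrγ hmono) (by positivity)
      _ = c * s ^ (-β) := by rw [hc, rpow_neg hs0.le, mul_comm]
  have hβ' : -β < -1 := by linarith
  have hint : ∫⁻ s in Ioi r, ENNReal.ofReal (s ^ (-β)) = ENNReal.ofReal (r ^ (1 - β) / (β - 1)) := by
    rw [← ofReal_integral_eq_lintegral_ofReal (integrableOn_Ioi_rpow_of_lt hβ' hr)
      (ae_restrict_of_forall_mem measurableSet_Ioi fun s hs => rpow_nonneg (hr.trans hs).le _),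
      integral_Ioi_rpow_of_lt hβ' hr]
    congr 1
    rw [show -β + 1 = 1 - β by ring, neg_div, ← div_neg, neg_sub]
  calc ∫⁻ s in Ioi r, ENNReal.ofReal ((s ^ β * log (exp 1 + s) ^ γ)⁻¹)
      ≤ ∫⁻ s in Ioi r, ENNReal.ofReal c * ENNReal.ofReal (s ^ (-β)) :=
        setLIntegral_mono' measurableSet_Ioi hpt
    _ = ENNReal.ofReal c * ENNReal.ofReal (r ^ (1 - β) / (β - 1)) := by
        rw [lintegral_const_mul' _ _ ENNReal.ofReal_ne_top, hint]
    _ = ENNReal.ofReal (r ^ (1 - β) / ((β - 1) * log (exp 1 + r) ^ γ)) := by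
        rw [← ENNReal.ofReal_mul hc0, hc]
        congr 1
        field_simp

end Literature.Analysis.FluidPDE

end
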